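/-
Copyright (c) 2026 the pub-hodgecm-mathlib formalisation cell (harness21).  Prover seat hodgecm-mathlib-K2E1-p15 (g0), Track B ∕ K2-LIT «5Res (b) BL-2(χ,τ)», h413 =
`stmt-HodgeConjecture-24833`, line `K2_E1_TraceFormulaBeta`, route of record `HCCMUnconditional`; offer (b) on the K2 bus 2026-09-04T11:24Z (R34, own block): the `(χ, τ)`
twin of ★ P6′ §2 `hunq_of_memLp_{of_lt,two}` ∕ ★ `K2E1BLUniquenessHunqCM.hunq_cm_two`, PAYING the `hunq` letter of row 12b ★ p859726 `K2E1ChiEisensteinMeromorphicBallU2`.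
-/
import Summits.HodgeConjecture.HodgeConjecture.Theorems.K2E1ChiHomogeneousL2U2          -- (this seat) `hL2_chi_cm_two` (+ ★ `K2E1BLHomogeneousL2U2`)
import Summits.HodgeConjecture.HodgeConjecture.Theorems.K2E1BLUniquenessSelfAdjointU2   -- ★ P6′ (K2E1-p02): `uniqueSetSA_nonempty_two`, `exists_memLp_toLp_eq_integratedOperator_of_ae_eq`, `absolutelyContinuous_withDensity_weightX`, `eq_zero_of_integratedOperator_rightRegular_eq_smul`
import HarnessLib

/-!
# K2·E1 — `K2E1ChiUniquenessHunqCMTwo`: «L² + SELF-ADJOINT» UNIQUENESS FOR THE `(χ, τ)` `𝔛`-SYSTEM OF ONE BALL, AND ROW 12b's LETTER `hunq` PAID (CM pair, `N = 2`) —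
# the `(χ,τ)` twin of ★ P6′ §2 `hunq_of_memLp_{of_lt,two}` ∕ ★ `K2E1BLUniquenessHunqCM.hunq_cm_two` (constant term `φ₀•α₁ z + L z b`, `b ∈ B` finite-dimensional)

Track B ∕ K2-LIT, crux h413 = `stmt-HodgeConjecture-24833`; cell `hodgecm-mathlib`, squad K2, ENGINE E1, campaign «5Res», road «BL-2(χ,τ) ∘ MS-2(χ,τ) ∘ ARCH-UNITARITY ∘ R8₂»
(SHEET rows 11–13; dealer ruling (119)(3) «arch-only test functions act by scalars»: the Hecke clause stays SCALAR, `T_i ψ = ĥ_i(z)•ψ`, as in ★ row 12b ED. 1).  THEOREMS ONLY (no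
`def`, no `instance`, no notation, no named-fact hypothesis, no `sorry`); lane `--kind proof --supports stmt-HodgeConjecture-24833 --as helper` (count-neutral).  Closes no socket.

THE MECHANISM ([BernsteinLapid2019, §4 Claim 2 (p. 9), Thm 2.3]; ★ P6′).  Two solutions `(ψ, b)`, `(eX z, bX z)` of the `(χ,τ)` system at `z` differ by a HOMOGENEOUS solution `ψ′ = ψ − eX z`:
`T_i ψ′ = ĥ_i(z)•ψ′`, constant term `cnstN(ιψ′) = L z (b − bX z)` (linearity of the finite-dimensional family `L z : B →L 𝓗_k(Z_a)` — the ONLY change w.r.t. the spherical `(b − bX z)•α₂ z`),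
`Q ψ′ = 0`; by the `L²`-letter `hL2` (★ `K2E1ChiHomogeneousL2U2.hL2_chi_cm_two`, item (i)) `ψ′ ∈ L²(μ)`; its `L²`-class is an eigenvector of the SELF-ADJOINT `R(h_{i₀})` (`h_{i₀}` symmetric
real, ★ P6′ §1.1 + the ★ `L²`-bridge) with the NON-REAL eigenvalue `ĥ_{i₀}(z)` on `U₀ = ball ∩ {σ₀ < Re} ∩ {Im ĥ_{i₀} ≠ 0}` (open, and non-empty at `N = 2` by ★ `uniqueSetSA_nonempty_two`),
hence `0`.  So `ψ = eX z` — the `ψ`-component is unique; with `L z` injective the `b`-component follows (★ 11b `xSystem_existsUnique_of_finDim`, used by row 12b).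
* §1 **`hunq_of_memLp_of_lt_finDim`** (rank `N`, threshold `σ₀`, letters `hne` and `hL2`) — ★ `hunq_of_memLp_of_lt` with `bX : ℂ → B`, `L : ℂ → B →L V`, `P(ιψ) = φ₀•α₁ z + L z b`.
* §2 **`hunq_of_memLp_two_finDim`** (`N = 2`, `σ₀ = 1`, `c² = 1`: `hne` discharged by ★ `uniqueSetSA_nonempty_two`).
* §3 **`hunq_chi_cm_two`** — ROW 12b's LETTER `hunq` (★ p859726, `σ₀ = 1`) BYTE-FOR-BYTE (`ι := iota hb`, `P := cnstN k a μZ`): §2 fed with ★ `hL2_chi_cm_two`; letters left: `hT`∕`hδι`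
  (★ P3-C), `hK1` at `i₀` (★ `hK1_cm_two_of`), `hδL` (★ `K2E1ChiHomogeneousL2U2` §2, columnwise), `hsolT hsolC hsolQ` (★ row 11 `K2E1ChiEisensteinSolvesXSystemU2`).

HONEST LABEL: HC_CM is proved only modulo the 7 printed citations (2 remaining named inputs: hLiu418 = `stmt-HodgeConjecture-24832`, h413 = `stmt-HodgeConjecture-24833`) until rung 0
closes; this file asserts no named fact and closes no socket.

## References
* [BernsteinLapid2019] J. Bernstein, E. Lapid, *On the meromorphic continuation of Eisenstein series*, J. AMS 37 (2024) (arXiv:1911.02342), §4 Claim 2 (p. 9), Thm 2.3.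
* [MoeglinWaldspurger1995] C. Mœglin, J.-L. Waldspurger, *Spectral Decomposition and Eisenstein Series* (1995), IV.1.9.
* [BorelJacquet1979] A. Borel, H. Jacquet, *Automorphic forms and automorphic representations*, Proc. Symp. Pure Math. 33.1 (1979), §4.6.
-/

set_option autoImplicit false
set_option linter.dupNamespace false  -- the mandated namespace repeats the summit's segment (`HodgeConjecture.HodgeConjecture`)

noncomputable section

open MeasureTheory Measure Set NumberField IsDedekindDomain Filter Topology Metric CompactlySupported
open scoped NNReal ENNReal InnerProductSpace ComplexConjugate
open Literature.MeasureTheory.Group Literature.NumberTheory.Automorphic Literature.NumberTheory.Automorphic.UnitaryGroup AdelicGroupData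
open Summit.HodgeConjecture.HodgeConjecture.Cruxes.H413.K2E1BLBorelSpacesU2Defs
open Summit.HodgeConjecture.HodgeConjecture.Cruxes.H413.K2E1BLBorelOperatorsU2Defs
open Summit.HodgeConjecture.HodgeConjecture.Cruxes.H413.K2E1SphericalHeckeEigenSectionU2 (differentiable_integral_mul_borelHeight_cpow)
open Summit.HodgeConjecture.HodgeConjecture.Cruxes.H413.K2E1BLUniquenessSelfAdjointU2 (uniqueSetSA_nonempty_two exists_memLp_toLp_eq_integratedOperator_of_ae_eq absolutelyContinuous_withDensity_weightX eq_zero_of_integratedOperator_rightRegular_eq_smul)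
open Summit.HodgeConjecture.HodgeConjecture.Cruxes.H413.K2E1ChiHomogeneousL2U2 (hL2_chi_cm_two)

namespace Summit.HodgeConjecture.HodgeConjecture.Cruxes.H413.K2E1ChiUniquenessHunqCMTwo

/-! ## §1 The rank-generic head on the letters `hne`, `hT`, `hL2` -/

section Generic

variable {F E : Type} [Field F] [NumberField F] [Field E] [NumberField E] [Algebra F E] {c : E ≃ₐ[F] E} {N : ℕ} [NeZero N]
  [MeasurableSpace (quasiSplit F E c N).Adelic] [BorelSpace (quasiSplit F E c N).Adelic]
  (μ : Measure (quasiSplit F E c N).automorphicQuotient) [(quasiSplit F E c N).IsAutomorphicMeasure μ]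
  (νG : Measure (quasiSplit F E c N).Adelic) [νG.IsHaarMeasure] [νG.IsInvInvariant] (k : ℕ)

/-- **THE `(χ, τ)` UNIQUENESS HEAD, «L² + SELF-ADJOINT», THRESHOLD-PARAMETRIC AND RANK-GENERIC** — ★ P6′ `hunq_of_memLp_of_lt` with the scalar second constant-term vector replaced by a
finite-dimensional family: `L : ℂ → B →L V`, `bX : ℂ → B`, constant-term condition `P(ιψ) = φ₀•α₁ z + L z b`.  Data: `X = 𝓗_k(𝔛)` for an automorphic `μ`; an inversion-invariant Haar
measure `νG`; test functions `h i` continuous of compact support with `h i₀` SYMMETRIC and REAL and `Im ĥ_{i₀} ≠ 0` somewhere on `ball 0 (n+2) ∩ {σ₀ < Re}` (letter `hne`); Hecke operators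
`T i : X →L X` with `T i₀` of P3-C's shape (letter `hT`); abstract `ι P α₁ L Q φ₀`; the GIVEN solution `(eX, bX)` (`hsolT hsolC hsolQ`); the `L²`-LETTER `hL2` (a homogeneous solution —
`T i ψ = ĥ_i(z)ψ`, `P(ιψ) = L z b′`, `Q ψ = 0` — at a point of `U₀` is in `L²(μ)`).  THEN every solution `(ψ, b)` at `z ∈ U₀ := ball ∩ {σ₀ < Re} ∩ {Im ĥ_{i₀} ≠ 0}` has `ψ = eX z`.
[cite: BernsteinLapid2019, §4 Claim 2 (p. 9), Thm 2.3] [cite: MoeglinWaldspurger1995, IV.1.9] -/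
theorem hunq_of_memLp_of_lt_finDim (σ₀ : ℝ) (n : ℕ) {I : Type*} (i₀ : I) {h : I → (quasiSplit F E c N).Adelic → ℂ}
    (hhc : ∀ i, Continuous (h i)) (hhs : ∀ i, HasCompactSupport (h i)) (hsymm : ∀ g, h i₀ g⁻¹ = h i₀ g) (hreal : ∀ g, conj (h i₀ g) = h i₀ g)
    (hne : (ball (0 : ℂ) (n + 2) ∩ {z : ℂ | σ₀ < z.re} ∩ {z : ℂ | (∫ x, h i₀ x * (((borelHeight x : ℝ≥0) : ℝ) : ℂ) ^ z ∂νG).im ≠ 0}).Nonempty)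
    (T : I → HX F E c N k μ →L[ℂ] HX F E c N k μ)
    (hT : ∀ u : HX F E c N k μ, ((T i₀ u : HX F E c N k μ) : (quasiSplit F E c N).automorphicQuotient → ℂ) =ᵐ[μ.withDensity fun x => (((supHeight F E c N x)⁻¹ ^ (2 * k) : ℝ≥0) : ℝ≥0∞)]
      fun ξ => ∫ y, h i₀ y * (u : (quasiSplit F E c N).automorphicQuotient → ℂ) (y⁻¹ • ξ) ∂νG)
    {V : Type*} [NormedAddCommGroup V] [NormedSpace ℂ V] (ι : HX F E c N k μ →L[ℂ] V) (P : V →L[ℂ] V) (α₁ : ℂ → V)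
    {B : Type*} [NormedAddCommGroup B] [NormedSpace ℂ B] (L : ℂ → B →L[ℂ] V)
    {X' : Type*} [NormedAddCommGroup X'] [NormedSpace ℂ X'] (Q : HX F E c N k μ →L[ℂ] X') (φ₀ : ℂ) (eX : ℂ → HX F E c N k μ) (bX : ℂ → B)
    (hsolT : ∀ z ∈ ball (0 : ℂ) (n + 2), σ₀ < z.re → ∀ i, T i (eX z) = (∫ x, h i x * (((borelHeight x : ℝ≥0) : ℝ) : ℂ) ^ z ∂νG) • eX z)
    (hsolC : ∀ z ∈ ball (0 : ℂ) (n + 2), σ₀ < z.re → P (ι (eX z)) = φ₀ • α₁ z + L z (bX z))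
    (hsolQ : ∀ z ∈ ball (0 : ℂ) (n + 2), σ₀ < z.re → Q (eX z) = 0)
    (hL2 : ∀ z ∈ ball (0 : ℂ) (n + 2), σ₀ < z.re → (∫ x, h i₀ x * (((borelHeight x : ℝ≥0) : ℝ) : ℂ) ^ z ∂νG).im ≠ 0 →
      ∀ (ψ : HX F E c N k μ) (b' : B), (∀ i, T i ψ = (∫ x, h i x * (((borelHeight x : ℝ≥0) : ℝ) : ℂ) ^ z ∂νG) • ψ) → P (ι ψ) = L z b' → Q ψ = 0 →
        MemLp (ψ : (quasiSplit F E c N).automorphicQuotient → ℂ) 2 μ) :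
    ∃ U₀ : Set ℂ, IsOpen U₀ ∧ U₀.Nonempty ∧ U₀ ⊆ ball (0 : ℂ) (n + 2) ∩ {z : ℂ | σ₀ < z.re} ∧
      ∀ z ∈ U₀, ∀ (ψ : HX F E c N k μ) (b : B), (∀ i, T i ψ = (∫ x, h i x * (((borelHeight x : ℝ≥0) : ℝ) : ℂ) ^ z ∂νG) • ψ) →
        P (ι ψ) = φ₀ • α₁ z + L z b → Q ψ = 0 → ψ = eX z := by
  refine ⟨ball (0 : ℂ) (n + 2) ∩ {z : ℂ | σ₀ < z.re} ∩ {z : ℂ | (∫ x, h i₀ x * (((borelHeight x : ℝ≥0) : ℝ) : ℂ) ^ z ∂νG).im ≠ 0}, ?_, hne, inter_subset_left, ?_⟩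
  · exact (isOpen_ball.inter (isOpen_lt continuous_const Complex.continuous_re)).inter
      (isOpen_ne_fun (Complex.continuous_im.comp (differentiable_integral_mul_borelHeight_cpow νG (hhc i₀) (hhs i₀)).continuous) continuous_const)
  rintro z ⟨⟨hzb, hzσ⟩, hzim⟩ ψ b hTψ hPψ hQψ
  -- the difference `ψ - eX z` is a HOMOGENEOUS solution with constant term `L z (b - bX z)`
  have hT' : ∀ i, T i (ψ - eX z) = (∫ x, h i x * (((borelHeight x : ℝ≥0) : ℝ) : ℂ) ^ z ∂νG) • (ψ - eX z) := fun i => by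
    rw [map_sub, hTψ i, hsolT z hzb hzσ i, smul_sub]
  have hP' : P (ι (ψ - eX z)) = L z (b - bX z) := by
    rw [map_sub, map_sub, hPψ, hsolC z hzb hzσ, map_sub]; abel
  have hQ' : Q (ψ - eX z) = 0 := by rw [map_sub, hQψ, hsolQ z hzb hzσ, sub_zero]
  -- hence in `L²(μ)` (the letter), where its class is an eigenvector of the self-adjoint `R(h i₀)` with the non-real eigenvalue `ĥ_{i₀}(z)`
  have hL : MemLp ((ψ - eX z : HX F E c N k μ) : (quasiSplit F E c N).automorphicQuotient → ℂ) 2 μ := hL2 z hzb hzσ hzim (ψ - eX z) (b - bX z) hT' hP' hQ'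
  obtain ⟨hTv, hcomp⟩ := exists_memLp_toLp_eq_integratedOperator_of_ae_eq μ νG k (hhc i₀) (hhs i₀) (T i₀) hT (ψ - eX z) hL
  have hμw := absolutelyContinuous_withDensity_weightX (F := F) (E := E) (c := c) (N := N) μ k
  have hwμ : (μ.withDensity fun x => (((supHeight F E c N x)⁻¹ ^ (2 * k) : ℝ≥0) : ℝ≥0∞)) ≪ μ := withDensity_absolutelyContinuous μ _
  have hae : ((T i₀ (ψ - eX z) : HX F E c N k μ) : (quasiSplit F E c N).automorphicQuotient → ℂ) =ᵐ[μ]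
      (∫ x, h i₀ x * (((borelHeight x : ℝ≥0) : ℝ) : ℂ) ^ z ∂νG) • ((ψ - eX z : HX F E c N k μ) : (quasiSplit F E c N).automorphicQuotient → ℂ) := by
    have h1 : ((T i₀ (ψ - eX z) : HX F E c N k μ) : (quasiSplit F E c N).automorphicQuotient → ℂ) =ᵐ[μ.withDensity fun x => (((supHeight F E c N x)⁻¹ ^ (2 * k) : ℝ≥0) : ℝ≥0∞)]
        (((∫ x, h i₀ x * (((borelHeight x : ℝ≥0) : ℝ) : ℂ) ^ z ∂νG) • (ψ - eX z) : HX F E c N k μ) : (quasiSplit F E c N).automorphicQuotient → ℂ) := by rw [hT' i₀]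
    exact (h1.trans (Lp.coeFn_smul _ _)).filter_mono hμw.ae_le
  have heig : ((quasiSplit F E c N).rightRegular μ).integratedOperator ((quasiSplit F E c N).isUnitary_rightRegular μ)
        ((quasiSplit F E c N).isStronglyContinuous_rightRegular_holds μ) νG ⟨⟨h i₀, hhc i₀⟩, hhs i₀⟩ (hL.toLp _) =
      (∫ x, h i₀ x * (((borelHeight x : ℝ≥0) : ℝ) : ℂ) ^ z ∂νG) • hL.toLp _ := by
    rw [← hcomp, ← MemLp.toLp_const_smul]
    exact (MemLp.toLp_eq_toLp_iff hTv (hL.const_smul _)).2 hae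
  have hzero : hL.toLp _ = 0 :=
    eq_zero_of_integratedOperator_rightRegular_eq_smul (quasiSplit F E c N) μ νG ⟨⟨h i₀, hhc i₀⟩, hhs i₀⟩ hsymm hreal hzim heig
  -- back to `X`: `ψ - eX z = 0`
  have hae0 : ((ψ - eX z : HX F E c N k μ) : (quasiSplit F E c N).automorphicQuotient → ℂ) =ᵐ[μ] 0 := by
    have h0 := MemLp.coeFn_toLp hL
    rw [hzero] at h0
    exact ((Lp.coeFn_zero ℂ 2 μ).symm.trans h0).symm
  exact sub_eq_zero.1 (Lp.eq_zero_iff_ae_eq_zero.2 (hae0.filter_mono hwμ.ae_le))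

end Generic

/-! ## §2 The head at `N = 2` (`σ₀ = 1`), `hne` discharged -/

section Two

/-- **THE `(χ, τ)` UNIQUENESS HEAD AT `N = 2`** (`σ₀ = 1`; `c² = 1`): §1 with the non-emptiness of `U₀` DISCHARGED by ★ `uniqueSetSA_nonempty_two` from `Re h_{i₀} ≥ 0` and `h_{i₀}(1) ≠ 0`
(automatic for `h = η^∨ ∗ η`).  The single remaining letter is the `L²`-letter `hL2` (§3 pays it from ★ `K2E1ChiHomogeneousL2U2.hL2_chi_cm_two`). [cite: BernsteinLapid2019, §4 Claim 2 (p. 9), Thm 2.3] -/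
theorem hunq_of_memLp_two_finDim {F E : Type} [Field F] [NumberField F] [Field E] [NumberField E] [Algebra F E] {c : E ≃ₐ[F] E} (hc : c * c = 1)
    [MeasurableSpace (quasiSplit F E c 2).Adelic] [BorelSpace (quasiSplit F E c 2).Adelic]
    (μ : Measure (quasiSplit F E c 2).automorphicQuotient) [(quasiSplit F E c 2).IsAutomorphicMeasure μ]
    (νG : Measure (quasiSplit F E c 2).Adelic) [νG.IsHaarMeasure] [νG.IsInvInvariant] (k n : ℕ) {I : Type*} (i₀ : I) {h : I → (quasiSplit F E c 2).Adelic → ℂ}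
    (hhc : ∀ i, Continuous (h i)) (hhs : ∀ i, HasCompactSupport (h i)) (hsymm : ∀ g, h i₀ g⁻¹ = h i₀ g) (hreal : ∀ g, conj (h i₀ g) = h i₀ g)
    (h0 : ∀ g, 0 ≤ (h i₀ g).re) (hh1 : h i₀ 1 ≠ 0)
    (T : I → HX F E c 2 k μ →L[ℂ] HX F E c 2 k μ)
    (hT : ∀ u : HX F E c 2 k μ, ((T i₀ u : HX F E c 2 k μ) : (quasiSplit F E c 2).automorphicQuotient → ℂ) =ᵐ[μ.withDensity fun x => (((supHeight F E c 2 x)⁻¹ ^ (2 * k) : ℝ≥0) : ℝ≥0∞)]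
      fun ξ => ∫ y, h i₀ y * (u : (quasiSplit F E c 2).automorphicQuotient → ℂ) (y⁻¹ • ξ) ∂νG)
    {V : Type*} [NormedAddCommGroup V] [NormedSpace ℂ V] (ι : HX F E c 2 k μ →L[ℂ] V) (P : V →L[ℂ] V) (α₁ : ℂ → V)
    {B : Type*} [NormedAddCommGroup B] [NormedSpace ℂ B] (L : ℂ → B →L[ℂ] V)
    {X' : Type*} [NormedAddCommGroup X'] [NormedSpace ℂ X'] (Q : HX F E c 2 k μ →L[ℂ] X') (φ₀ : ℂ) (eX : ℂ → HX F E c 2 k μ) (bX : ℂ → B)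
    (hsolT : ∀ z ∈ ball (0 : ℂ) (n + 2), 1 < z.re → ∀ i, T i (eX z) = (∫ x, h i x * (((borelHeight x : ℝ≥0) : ℝ) : ℂ) ^ z ∂νG) • eX z)
    (hsolC : ∀ z ∈ ball (0 : ℂ) (n + 2), 1 < z.re → P (ι (eX z)) = φ₀ • α₁ z + L z (bX z))
    (hsolQ : ∀ z ∈ ball (0 : ℂ) (n + 2), 1 < z.re → Q (eX z) = 0)
    (hL2 : ∀ z ∈ ball (0 : ℂ) (n + 2), 1 < z.re → (∫ x, h i₀ x * (((borelHeight x : ℝ≥0) : ℝ) : ℂ) ^ z ∂νG).im ≠ 0 →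
      ∀ (ψ : HX F E c 2 k μ) (b' : B), (∀ i, T i ψ = (∫ x, h i x * (((borelHeight x : ℝ≥0) : ℝ) : ℂ) ^ z ∂νG) • ψ) → P (ι ψ) = L z b' → Q ψ = 0 →
        MemLp (ψ : (quasiSplit F E c 2).automorphicQuotient → ℂ) 2 μ) :
    ∃ U₀ : Set ℂ, IsOpen U₀ ∧ U₀.Nonempty ∧ U₀ ⊆ ball (0 : ℂ) (n + 2) ∩ {z : ℂ | 1 < z.re} ∧
      ∀ z ∈ U₀, ∀ (ψ : HX F E c 2 k μ) (b : B), (∀ i, T i ψ = (∫ x, h i x * (((borelHeight x : ℝ≥0) : ℝ) : ℂ) ^ z ∂νG) • ψ) →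
        P (ι ψ) = φ₀ • α₁ z + L z b → Q ψ = 0 → ψ = eX z := by
  have hre : ∀ g, (((h i₀ g).re : ℝ) : ℂ) = h i₀ g := fun g => Complex.conj_eq_iff_re.1 (hreal g)
  refine hunq_of_memLp_of_lt_finDim μ νG k 1 n i₀ hhc hhs hsymm hreal ?_ T hT ι P α₁ L Q φ₀ eX bX hsolT hsolC hsolQ hL2
  have hne := uniqueSetSA_nonempty_two hc νG (h := fun g => (h i₀ g).re) (Complex.continuous_re.comp (hhc i₀)) ((hhs i₀).comp_left Complex.zero_re) h0
    (fun h01 => hh1 (by rw [← hre 1, h01, Complex.ofReal_zero])) n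
  have hfun : h i₀ = fun g => (((h i₀ g).re : ℝ) : ℂ) := funext fun g => (hre g).symm
  rw [hfun]
  exact hne

end Two

/-! ## §3 ROW 12b's LETTER `hunq` PAID for the CM pair at `N = 2` -/

section CM

variable (L : Type) [Field L] [NumberField L] [IsCMField L]
  [MeasurableSpace (quasiSplit (↥(maximalRealSubfield L)) L (IsCMField.complexConj L) 2).Adelic]
  [BorelSpace (quasiSplit (↥(maximalRealSubfield L)) L (IsCMField.complexConj L) 2).Adelic]

/-- **ROW 12b's `hunq` FOR THE `(χ, τ)` BALL AT THE CM PAIR, `N = 2`, ONE CALL** — the conclusion is the `hunq` letter of ★ p859726 `chiEisenstein_meromorphicOn_ball_of_letters` (`σ₀ = 1`)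
byte-for-byte (`ι := iota hb`, `P := cnstN k a μZ`, constant term `φ₀ • α₁ z + Lz z b`); the proof is §2 fed with ★ `K2E1ChiHomogeneousL2U2.hL2_chi_cm_two` (item (i)); `c² = 1` holds for the
CM involution.  Letters left to the caller: `hT`∕`hδι` (★ P3-C `exists_heckePackage′`), `hK1` at `i₀` (★ `hK1_cm_two_of`), `hδL` (★ `K2E1ChiHomogeneousL2U2` §2: per column of `Lz z` from
`α₂ j z =ᵐ zFun φ′_j · HZ^{1−z}`), `hsolT hsolC hsolQ` (★ row 11). [cite: BernsteinLapid2019, Thm 2.3 and §4 Claim 2 (p. 9)] [cite: MoeglinWaldspurger1995, IV.1.9] -/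
theorem hunq_chi_cm_two
    (μ : Measure (quasiSplit (↥(maximalRealSubfield L)) L (IsCMField.complexConj L) 2).automorphicQuotient)
    [(quasiSplit (↥(maximalRealSubfield L)) L (IsCMField.complexConj L) 2).IsAutomorphicMeasure μ]
    (νG : Measure (quasiSplit (↥(maximalRealSubfield L)) L (IsCMField.complexConj L) 2).Adelic) [νG.IsHaarMeasure] [νG.IsInvInvariant]
    {β : (quasiSplit (↥(maximalRealSubfield L)) L (IsCMField.complexConj L) 2).Adelic → ℝ≥0∞}
    (hβ : IsCoveringWeight ↥((arithmeticBorel (↥(maximalRealSubfield L)) L (IsCMField.complexConj L) 2).map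
      (quasiSplit (↥(maximalRealSubfield L)) L (IsCMField.complexConj L) 2).arithmeticSubgroup.subtype) β)
    {μZ : Measure (borelQuotient (↥(maximalRealSubfield L)) L (IsCMField.complexConj L) 2)}
    (hμZ : ∀ f : borelQuotient (↥(maximalRealSubfield L)) L (IsCMField.complexConj L) 2 → ℝ≥0∞, Measurable f →
      ∫⁻ z, f z ∂μZ = ∫⁻ g, β g * f (toBorelQuotient (↥(maximalRealSubfield L)) L (IsCMField.complexConj L) 2 g) ∂νG)
    (k n : ℕ) {I : Type*} (i₀ : I) {h : I → (quasiSplit (↥(maximalRealSubfield L)) L (IsCMField.complexConj L) 2).Adelic → ℂ}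
    (hhc : ∀ i, Continuous (h i)) (hhs : ∀ i, HasCompactSupport (h i)) (hsymm : ∀ g, h i₀ g⁻¹ = h i₀ g) (hreal : ∀ g, conj (h i₀ g) = h i₀ g)
    (h0 : ∀ g, 0 ≤ (h i₀ g).re) (hh1 : h i₀ 1 ≠ 0)
    {a a₀ : ℝ≥0} (ha₀ : 0 < a₀) (haa₀ : a ≤ a₀) (hfin : μZ {z | a < borelQuotHeight (↥(maximalRealSubfield L)) L (IsCMField.complexConj L) 2 z} ≠ ∞)
    (hb : IotaBound (↥(maximalRealSubfield L)) L (IsCMField.complexConj L) 2 k a μ μZ)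
    (hs : ShiftBound (↥(maximalRealSubfield L)) L (IsCMField.complexConj L) 2 k a a₀ νG μZ (h i₀))
    (T : I → HX (↥(maximalRealSubfield L)) L (IsCMField.complexConj L) 2 k μ →L[ℂ] HX (↥(maximalRealSubfield L)) L (IsCMField.complexConj L) 2 k μ)
    (hT : ∀ u : HX (↥(maximalRealSubfield L)) L (IsCMField.complexConj L) 2 k μ,
      ((T i₀ u : HX (↥(maximalRealSubfield L)) L (IsCMField.complexConj L) 2 k μ) : (quasiSplit (↥(maximalRealSubfield L)) L (IsCMField.complexConj L) 2).automorphicQuotient → ℂ)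
        =ᵐ[μ.withDensity fun x => (((supHeight (↥(maximalRealSubfield L)) L (IsCMField.complexConj L) 2 x)⁻¹ ^ (2 * k) : ℝ≥0) : ℝ≥0∞)]
      fun ξ => ∫ y, h i₀ y * (u : (quasiSplit (↥(maximalRealSubfield L)) L (IsCMField.complexConj L) 2).automorphicQuotient → ℂ) (y⁻¹ • ξ) ∂νG)
    (hδι : deltaShift hs ∘L iota hb = restrHN (↥(maximalRealSubfield L)) L (IsCMField.complexConj L) 2 k haa₀ μZ ∘L iota hb ∘L T i₀)
    {C m : ℝ} (hC : 0 ≤ C) (hm : 0 ≤ m)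
    (hK1 : ∀ f : HNcusp (↥(maximalRealSubfield L)) L (IsCMField.complexConj L) 2 k a μZ,
      ∀ᵐ x ∂(weightedTruncMeasure (↥(maximalRealSubfield L)) L (IsCMField.complexConj L) 2 k a₀ μZ),
        ‖rightConvFun (↥(maximalRealSubfield L)) L (IsCMField.complexConj L) 2 νG (h i₀)
            ((f : HN (↥(maximalRealSubfield L)) L (IsCMField.complexConj L) 2 k a μZ) : borelQuotient (↥(maximalRealSubfield L)) L (IsCMField.complexConj L) 2 → ℂ) x‖ ≤
          C * ‖f‖ * ((borelQuotHeight (↥(maximalRealSubfield L)) L (IsCMField.complexConj L) 2 x : ℝ)) ^ (-m))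
    (α₁ : ℂ → HN (↥(maximalRealSubfield L)) L (IsCMField.complexConj L) 2 k a μZ)
    {B : Type*} [NormedAddCommGroup B] [NormedSpace ℂ B] (Lz : ℂ → B →L[ℂ] HN (↥(maximalRealSubfield L)) L (IsCMField.complexConj L) 2 k a μZ)
    (hδL : ∀ z ∈ ball (0 : ℂ) (n + 2), 1 < z.re → ∀ b' : B, ∃ M : ℝ, ∀ᵐ x ∂(weightedTruncMeasure (↥(maximalRealSubfield L)) L (IsCMField.complexConj L) 2 k a₀ μZ),
      ‖(deltaShift hs (Lz z b') : borelQuotient (↥(maximalRealSubfield L)) L (IsCMField.complexConj L) 2 → ℂ) x‖ ≤ M)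
    {X' : Type*} [NormedAddCommGroup X'] [NormedSpace ℂ X'] (Q : HX (↥(maximalRealSubfield L)) L (IsCMField.complexConj L) 2 k μ →L[ℂ] X') (φ₀ : ℂ)
    (eX : ℂ → HX (↥(maximalRealSubfield L)) L (IsCMField.complexConj L) 2 k μ) (bX : ℂ → B)
    (hsolT : ∀ z ∈ ball (0 : ℂ) (n + 2), 1 < z.re → ∀ i, T i (eX z) = (∫ x, h i x * (((borelHeight x : ℝ≥0) : ℝ) : ℂ) ^ z ∂νG) • eX z)
    (hsolC : ∀ z ∈ ball (0 : ℂ) (n + 2), 1 < z.re →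
      cnstN (↥(maximalRealSubfield L)) L (IsCMField.complexConj L) 2 k a μZ (iota hb (eX z)) = φ₀ • α₁ z + Lz z (bX z))
    (hsolQ : ∀ z ∈ ball (0 : ℂ) (n + 2), 1 < z.re → Q (eX z) = 0) :
    ∃ U₀ : Set ℂ, IsOpen U₀ ∧ U₀.Nonempty ∧ U₀ ⊆ ball (0 : ℂ) (n + 2) ∩ {z : ℂ | 1 < z.re} ∧
      ∀ z ∈ U₀, ∀ (ψ : HX (↥(maximalRealSubfield L)) L (IsCMField.complexConj L) 2 k μ) (b : B),
        (∀ i, T i ψ = (∫ x, h i x * (((borelHeight x : ℝ≥0) : ℝ) : ℂ) ^ z ∂νG) • ψ) →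
          cnstN (↥(maximalRealSubfield L)) L (IsCMField.complexConj L) 2 k a μZ (iota hb ψ) = φ₀ • α₁ z + Lz z b → Q ψ = 0 → ψ = eX z :=
  hunq_of_memLp_two_finDim (AlgEquiv.ext fun x => by rw [AlgEquiv.mul_apply, AlgEquiv.one_apply, IsCMField.complexConj_apply_apply])
    μ νG k n i₀ hhc hhs hsymm hreal h0 hh1 T hT (iota hb) (cnstN (↥(maximalRealSubfield L)) L (IsCMField.complexConj L) 2 k a μZ) α₁ Lz Q φ₀ eX bX hsolT hsolC hsolQ
    (hL2_chi_cm_two L μ νG hβ hμZ k n i₀ ha₀ haa₀ hfin hb hs T hδι hC hm hK1 Lz hδL Q)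

end CM

end Summit.HodgeConjecture.HodgeConjecture.Cruxes.H413.K2E1ChiUniquenessHunqCMTwo

end
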